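import Summits.Ventures.Crystal3D.Theorems.StickyWulffConstantCoaxialWallLawVicinalDeepSplit
import Summits.Ventures.Crystal3D.Theorems.StickyWulffConstantCoaxialWallLawVicinalCoreCapstone
import HarnessLib

/-!
# Capstone: `CoaxialWallLaw` BY NAME ⇐ {E1, `StarPairFar`, coherent-twin debt, coherent-fault debt, DEEP incoherent debt}
# (crux `CoaxialWallLaw`, stmt-Ventures-19481, line `WallLedgerF`)

HONEST FRAMING. Venture `Summits/Ventures/Crystal3D` (cell `crystal3d-full`), helper `--supports` the crux
`CoaxialWallLaw` of `route-Ventures-StickyWulffConstant` (REGISTERED line `WallLedgerF`).  LEAF capstone (nothing should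
import this file).  Book-keeping only; F-C1 not moved; NOT the crux: the three debts are OPEN —
`CoaxialTwoSlabAdhesionCoherentTwin` (vicinal coherent Σ3 twins: census), `CoaxialTwoSlabAdhesionCoherentFault` (vicinal basal
stacking faults: census), `CoaxialTwoSlabAdhesionIncoherentDeep` (triadic offsets of level `3^{-j}`, `j ≥ 2`, neither coherent:
THIN/THICK, (F-loc)); `ExactOnly`(C12-55) / `P5Exhaustion` [E1, certified] and `StarPairFar` [certified; kernel at
computational grade, `StarFar.starPairFar_holds`] are inputs BY NAME.  Lane F's debt of record after 19481-p1 gen 11.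

* **`coaxialWallLaw_of_deepSplit`**, **`coaxialWallLaw_of_p5_deepSplit`**.
WHAT THIS IS NOT: a proof of any debt; F-C1 not moved.
-/

noncomputable section

namespace Summit.Ventures.Crystal3D.Theorems

open Summit.Ventures.Crystal3D Finset
open Literature.MathematicalPhysics.StatisticalMechanics (fccStacking barlowStacking IsHaggSeq contactDeficiency)
open scoped InnerProductSpace

open scoped Classical in
/-- **The crux `CoaxialWallLaw` BY NAME from `ExactOnly`(C12-55), `StarPairFar` and the three debts of record** (coherent
twins, coherent faults, deep incoherent offsets). -/
theorem coaxialWallLaw_of_deepSplit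
    {s₀ : EuclideanSpace ℝ (Fin 3)} (hs₀ : s₀ ∈ fccSlots)
    (hcert : ExactOnly 0 (fccSlots.filter fun w => 0 < ⟪w, s₀⟫_ℝ)) (hSP : StarPairFar)
    (h₁ : CoaxialTwoSlabAdhesionCoherentTwin) (h₂ : CoaxialTwoSlabAdhesionCoherentFault)
    (h₃ : CoaxialTwoSlabAdhesionIncoherentDeep) :
    Summit.Ventures.Crystal3D.Theses.StickyWulffConstant.CoaxialWallLaw :=
  coaxialWallLaw_of_vicinal hs₀ hcert hSP (coaxialTwoSlabAdhesionVicinal_of_deepSplit h₁ h₂ h₃)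

/-- **The crux `CoaxialWallLaw` BY NAME from `P5Exhaustion` (E1), `StarPairFar` and the three debts of record.** -/
theorem coaxialWallLaw_of_p5_deepSplit (hE1 : P5Exhaustion) (hSP : StarPairFar)
    (h₁ : CoaxialTwoSlabAdhesionCoherentTwin) (h₂ : CoaxialTwoSlabAdhesionCoherentFault)
    (h₃ : CoaxialTwoSlabAdhesionIncoherentDeep) :
    Summit.Ventures.Crystal3D.Theses.StickyWulffConstant.CoaxialWallLaw := by
  obtain ⟨s₀, hs₀, hcert⟩ := exactOnly_star_of_p5Exhaustion hE1
  exact coaxialWallLaw_of_deepSplit hs₀ hcert hSP h₁ h₂ h₃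

end Summit.Ventures.Crystal3D.Theorems

end
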